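import Mathlib.Analysis.InnerProductSpace.PiL2
import Mathlib.Analysis.InnerProductSpace.Spectrum
import Mathlib.Analysis.InnerProductSpace.Adjoint
import Mathlib.Analysis.InnerProductSpace.Positive
import HarnessLib

/-!
# Eigenframes of a quadratic form `‖Dv‖²`: the sum `Σᵢ f(aᵢ)` over a diagonalising orthonormal frame does NOT depend on the frame
# (spectral-bridge brick C3a for the VALLEY term, crux `TwistedTraceScaling` stmt-QuantumFields-20203 S-BASE; design note
# `pub/ym-fleet/ym-luscher-20007-p1/COARSE-DESIGN.md` §12)

The Gaussian step at a flat background `V_θ` (lanes A/B of S-BASE) is written in SOME orthonormal eigenframe `(eᵢ, aᵢ)` of the covariant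
Hessian `D†D` (`D = covCurl V_θ`; Mathlib's `LinearMap.IsSymmetric.eigenvectorBasis`, or lane B's normal modes), and produces the factor
`Πᵢ √(π/(b + t aᵢ + cᵢ)) = √(π/b)^n · exp(−Σᵢ modeZPE(t aᵢ/b))` (`…ToronValley.prod_sqrt_pi_div_eq`).  The plane-wave computation of the
spectrum (`…ToronPlaneWaves`, `…ToronSpectrum`) uses a DIFFERENT frame.  This file supplies the (folklore) bridge: two orthonormal frames
diagonalising the same form `⟪D·, D·⟫` have the same value multiset, so `Σᵢ f(aᵢ)` agrees for every `f`.

* `Frame.IsDiag D e a` : `⟪D eᵢ, D eⱼ⟫ = δᵢⱼ aᵢ` (an orthonormal frame `e` diagonalising the form of `D`, values `aᵢ : ℝ`);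
* ★ `Frame.IsDiag.sum_eq_sum` : `IsDiag D e a → IsDiag D e' a' → Σᵢ f(aᵢ) = Σⱼ f(a'ⱼ)` (any index types, `𝕜 = ℝ` or `ℂ`);
* `Frame.IsDiag.norm_sq_eq_sum` : `IsDiag D e a → ‖Dx‖² = Σᵢ aᵢ‖⟪eᵢ,x⟫‖²`; real form `Frame.IsDiag.norm_sq_eq_sum_real`;
* `Frame.isDiag_of_apply_eq_smul` : an orthonormal eigenbasis of a `T` with `⟪x,Ty⟫ = ⟪Dx,Dy⟫` is a diagonalising frame; in particular
  `Frame.isDiag_eigenvectorBasis` for Mathlib's eigenframe of `D† ∘ D`; `Frame.nonneg` : the values are `≥ 0`.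

HONEST FRAMING: finite-dimensional linear algebra; femto rung R2b1 (brick for a stub of a child of a CONDITIONAL route); not a gap, not Clay.
-/

set_option autoImplicit false

noncomputable section

open scoped BigOperators InnerProductSpace

namespace Summit.QuantumFields.YangMills.Theorems.FemtoTransferGap.TwoLattice.Toron.Frame

variable {𝕜 : Type*} [RCLike 𝕜]
variable {E F : Type*} [NormedAddCommGroup E] [InnerProductSpace 𝕜 E] [NormedAddCommGroup F] [InnerProductSpace 𝕜 F]
variable {ι ι' : Type*} [Fintype ι] [Fintype ι'] [DecidableEq ι] [DecidableEq ι']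

/-- An orthonormal frame `e` DIAGONALISES the quadratic form of `D` with values `a`: `⟪D eᵢ, D eⱼ⟫ = δᵢⱼ·aᵢ`. [folklore] -/
def IsDiag (D : E →ₗ[𝕜] F) (e : OrthonormalBasis ι 𝕜 E) (a : ι → ℝ) : Prop :=
  ∀ i j, ⟪D (e i), D (e j)⟫_𝕜 = if i = j then ((a i : ℝ) : 𝕜) else 0

variable {D : E →ₗ[𝕜] F} {e : OrthonormalBasis ι 𝕜 E} {a : ι → ℝ} {e' : OrthonormalBasis ι' 𝕜 E} {a' : ι' → ℝ}

/-- In a diagonalising frame, `⟪D eᵢ, D x⟫ = aᵢ ⟪eᵢ, x⟫`. [folklore] -/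
theorem IsDiag.inner_apply_left (h : IsDiag D e a) (i : ι) (x : E) :
    ⟪D (e i), D x⟫_𝕜 = ((a i : ℝ) : 𝕜) * ⟪e i, x⟫_𝕜 := by
  conv_lhs => rw [← e.sum_repr' x]
  rw [map_sum, inner_sum]
  simp_rw [map_smul, inner_smul_right, h i]
  rw [Finset.sum_eq_single i (fun j _ hj => by rw [if_neg (Ne.symm hj), mul_zero]) (fun hi => absurd (Finset.mem_univ i) hi),
    if_pos rfl, mul_comm]

/-- Two diagonalising frames: `⟪eᵢ, e'ⱼ⟫ ≠ 0 ⇒ aᵢ = a'ⱼ`. [cite: HornJohnson2013, Thm 2.5.4] -/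
theorem IsDiag.eq_of_inner_ne_zero (h : IsDiag D e a) (h' : IsDiag D e' a') {i : ι} {j : ι'}
    (hij : ⟪e i, e' j⟫_𝕜 ≠ 0) : a i = a' j := by
  have h1 : ⟪D (e i), D (e' j)⟫_𝕜 = ((a i : ℝ) : 𝕜) * ⟪e i, e' j⟫_𝕜 := h.inner_apply_left i (e' j)
  have h2 : ⟪D (e i), D (e' j)⟫_𝕜 = ((a' j : ℝ) : 𝕜) * ⟪e i, e' j⟫_𝕜 := by
    rw [← inner_conj_symm, h'.inner_apply_left j (e i), map_mul, RCLike.conj_ofReal, inner_conj_symm]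
  have h3 : (((a i : ℝ) : 𝕜) - ((a' j : ℝ) : 𝕜)) * ⟪e i, e' j⟫_𝕜 = 0 := by rw [sub_mul, ← h1, ← h2, sub_self]
  rcases mul_eq_zero.1 h3 with h4 | h4
  · exact_mod_cast sub_eq_zero.1 h4
  · exact absurd h4 hij

/-- ★ **Frame independence**: if two orthonormal frames `e`, `e'` both diagonalise the form of `D`, with values `a`, `a'`, then
`Σᵢ f(aᵢ) = Σⱼ f(a'ⱼ)` for every `f` (the value multisets agree). [cite: HornJohnson2013, Thm 2.5.4] -/
theorem IsDiag.sum_eq_sum [FiniteDimensional 𝕜 E] (h : IsDiag D e a) (h' : IsDiag D e' a') (f : ℝ → ℝ) :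
    ∑ i, f (a i) = ∑ j, f (a' j) := by
  -- `Σᵢ f(aᵢ) = Σᵢ f(aᵢ) Σⱼ ‖⟪eᵢ,e'ⱼ⟫‖² = Σᵢⱼ f(a'ⱼ)‖⟪eᵢ,e'ⱼ⟫‖² = Σⱼ f(a'ⱼ)`
  have key : ∀ i j, f (a i) * ‖⟪e i, e' j⟫_𝕜‖ ^ 2 = f (a' j) * ‖⟪e i, e' j⟫_𝕜‖ ^ 2 := fun i j => by
    by_cases hij : ⟪e i, e' j⟫_𝕜 = 0
    · rw [hij, norm_zero, zero_pow two_ne_zero, mul_zero, mul_zero]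
    · rw [h.eq_of_inner_ne_zero h' hij]
  calc ∑ i, f (a i) = ∑ i, f (a i) * ∑ j, ‖⟪e i, e' j⟫_𝕜‖ ^ 2 := by
        refine Finset.sum_congr rfl fun i _ => ?_
        rw [e'.sum_sq_norm_inner_left (e i), e.orthonormal.1 i, one_pow, mul_one]
    _ = ∑ i, ∑ j, f (a' j) * ‖⟪e i, e' j⟫_𝕜‖ ^ 2 := by
        refine Finset.sum_congr rfl fun i _ => ?_
        rw [Finset.mul_sum]
        exact Finset.sum_congr rfl fun j _ => key i j
    _ = ∑ j, f (a' j) * ∑ i, ‖⟪e i, e' j⟫_𝕜‖ ^ 2 := by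
        rw [Finset.sum_comm]
        exact Finset.sum_congr rfl fun j _ => (Finset.mul_sum _ _ _).symm
    _ = ∑ j, f (a' j) := by
        refine Finset.sum_congr rfl fun j _ => ?_
        rw [e.sum_sq_norm_inner_right (e' j), e'.orthonormal.1 j, one_pow, mul_one]

/-- In a diagonalising frame the form is the weighted sum of squares: `‖Dx‖² = Σᵢ aᵢ‖⟪eᵢ,x⟫‖²`. [cite: HornJohnson2013, Thm 4.1.5] -/
theorem IsDiag.norm_sq_eq_sum (h : IsDiag D e a) (x : E) : ‖D x‖ ^ 2 = ∑ i, a i * ‖⟪e i, x⟫_𝕜‖ ^ 2 := by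
  have h1 : ⟪D x, D x⟫_𝕜 = ∑ i, ((a i : ℝ) : 𝕜) * ((‖⟪e i, x⟫_𝕜‖ ^ 2 : ℝ) : 𝕜) := by
    nth_rw 1 [← e.sum_repr' x]
    rw [map_sum, sum_inner]
    refine Finset.sum_congr rfl fun i _ => ?_
    rw [map_smul, inner_smul_left, h.inner_apply_left i x, ← mul_assoc, mul_comm _ (((a i : ℝ) : 𝕜)), mul_assoc,
      RCLike.conj_mul, RCLike.ofReal_pow]
  have h2 : (‖D x‖ ^ 2 : ℝ) = RCLike.re ⟪D x, D x⟫_𝕜 := (inner_self_eq_norm_sq (𝕜 := 𝕜) (D x)).symm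
  rw [h2, h1, map_sum]
  refine Finset.sum_congr rfl fun i _ => ?_
  rw [← RCLike.ofReal_mul, RCLike.ofReal_re]

/-- Real form: `‖Dx‖² = Σᵢ aᵢ⟪eᵢ,x⟫²`. [cite: HornJohnson2013, Thm 4.1.5] -/
theorem IsDiag.norm_sq_eq_sum_real {E F : Type*} [NormedAddCommGroup E] [InnerProductSpace ℝ E] [NormedAddCommGroup F]
    [InnerProductSpace ℝ F] {D : E →ₗ[ℝ] F} {e : OrthonormalBasis ι ℝ E} {a : ι → ℝ} (h : IsDiag D e a) (x : E) :
    ‖D x‖ ^ 2 = ∑ i, a i * ⟪e i, x⟫_ℝ ^ 2 := by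
  rw [h.norm_sq_eq_sum x]
  simp only [Real.norm_eq_abs, sq_abs]

/-- The values of a diagonalising frame are non-negative: `aᵢ = ‖D eᵢ‖² ≥ 0`. [folklore] -/
theorem IsDiag.nonneg (h : IsDiag D e a) (i : ι) : 0 ≤ a i := by
  have h1 := h i i
  rw [if_pos rfl, inner_self_eq_norm_sq_to_K] at h1
  have h2 : ‖D (e i)‖ ^ 2 = a i := by exact_mod_cast h1
  rw [← h2]; positivity

/-- An orthonormal EIGENBASIS of an operator `T` representing the form (`⟪x, T y⟫ = ⟪Dx, Dy⟫`, `T eᵢ = aᵢ eᵢ`) is a diagonalising frame.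
[folklore] -/
theorem isDiag_of_apply_eq_smul {T : E →ₗ[𝕜] E} (hT : ∀ x y, ⟪x, T y⟫_𝕜 = ⟪D x, D y⟫_𝕜)
    (he : ∀ i, T (e i) = ((a i : ℝ) : 𝕜) • e i) : IsDiag D e a := fun i j => by
  rw [← hT, he j, inner_smul_right, orthonormal_iff_ite.mp e.orthonormal i j]
  split_ifs with hij
  · subst hij; simp
  · simp

/-- Mathlib's eigenframe of `D† ∘ D` (finite dimension) is a diagonalising frame for the form of `D`. [cite: HornJohnson2013, Thm 2.5.6] -/
theorem isDiag_eigenvectorBasis [FiniteDimensional 𝕜 E] [FiniteDimensional 𝕜 F] (D : E →ₗ[𝕜] F) {n : ℕ}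
    (hn : Module.finrank 𝕜 E = n) :
    IsDiag D ((LinearMap.isPositive_adjoint_comp_self D).isSymmetric.eigenvectorBasis hn)
      ((LinearMap.isPositive_adjoint_comp_self D).isSymmetric.eigenvalues hn) := by
  refine isDiag_of_apply_eq_smul (T := D.adjoint ∘ₗ D) (fun x y => ?_) fun i => ?_
  · rw [LinearMap.comp_apply, LinearMap.adjoint_inner_right]
  · exact (LinearMap.isPositive_adjoint_comp_self D).isSymmetric.apply_eigenvectorBasis hn i

/-- A diagonalising frame transported along an equivalence of index types is one. [folklore] -/
theorem IsDiag.reindex (h : IsDiag D e a) (σ : ι ≃ ι') : IsDiag D (e.reindex σ) (a ∘ σ.symm) := fun i j => by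
  rw [e.reindex_apply, e.reindex_apply, h]
  simp only [Function.comp_apply, σ.symm.injective.eq_iff]

end Summit.QuantumFields.YangMills.Theorems.FemtoTransferGap.TwoLattice.Toron.Frame

end
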